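import Mathlib
import Summits.PneNP.PneNP.Theorems.LatticeMagicTargetIffNPneCoNP

/-!
# Sketch (crux-ideate r2, ideator 4) — crux `LatticeMagic.Target` (stmt-PneNP-10709)

Idea `krajicek-tpv-extension-split`.  Two checkable pieces:

1. `lwePair_uniqueError` / `lwePair_uniqueSecret`: the arithmetic behind the disjointness of the
   trapdoor-certified LWE pair (U₀, U₁) — a short full-rank integer matrix `T` with `T·A ≡ 0 (mod q)`
   forces unique decoding of `b ≡ A s + e (mod q)` with `‖e‖∞ ≤ D` once `2·D·‖row_j T‖₁ < q`, and a
   left inverse `L` of `A` mod `q` then pins `s mod q`.  This is what makes the axiom scheme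
   "U₀ ∩ U₁ = ∅" of the strong proof system `P_lat := EF + Disj(U₀,U₁)` consist of TAUTOLOGIES
   (Krajíček arXiv:2506.20221 §2: a strong pps is EF plus any p-time set of tautologies).
2. `target_of_krajicekSplit`: the shape of the line — Krajíček's Theorem 4.1
   (`ModelExt → ST → NP ≠ coNP`) composed with the LANDED tree lemma
   `latticeMagicTarget_of_NP_ne_coNP`.
-/

set_option linter.dupNamespace false

namespace Summit.PneNP.PneNP.Cruxes.Target.Ideator4

open Matrix BigOperators Finset

/-- **Unique error under a short full-rank certificate in Λ_q^⊥(A)** (integral ℓ∞/ℓ₁ form of the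
Aharonov–Regev / Micciancio–Peikert unique-decoding certificate).  If every entry of `T * A` is
divisible by `q`, `det T ≠ 0`, every row of `T` has `2·D·‖row‖₁ < q`, and
`A s + e ≡ A s' + e' (mod q)` coordinatewise with `‖e‖∞, ‖e'‖∞ ≤ D`, then `e = e'`. -/
theorem lwePair_uniqueError {m n : ℕ} (q D : ℤ)
    (A : Matrix (Fin m) (Fin n) ℤ) (T : Matrix (Fin m) (Fin m) ℤ)
    (hTA : ∀ j k, q ∣ (T * A) j k)
    (hTdet : T.det ≠ 0)
    (hTshort : ∀ j, 2 * D * ∑ k, |T j k| < q)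
    (s s' : Fin n → ℤ) (e e' : Fin m → ℤ)
    (he : ∀ k, |e k| ≤ D) (he' : ∀ k, |e' k| ≤ D)
    (hb : ∀ j, q ∣ (A *ᵥ s + e) j - (A *ᵥ s' + e') j) :
    e = e' := by
  set w : Fin m → ℤ := (e - e') - A *ᵥ (s' - s) with hwdef
  have hw : ∀ k, q ∣ w k := by
    intro k
    have h1 : w k = (A *ᵥ s + e) k - (A *ᵥ s' + e') k := by
      simp only [hwdef, Pi.sub_apply, Pi.add_apply, Matrix.mulVec_sub]
      ring
    rw [h1]
    exact hb k
  set B : Matrix (Fin m) (Fin n) ℤ := T * A with hBdef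
  have hsplit : T *ᵥ (e - e') = T *ᵥ w + B *ᵥ (s' - s) := by
    rw [hBdef, ← Matrix.mulVec_mulVec, ← Matrix.mulVec_add, hwdef, sub_add_cancel]
  have hdvd : ∀ j, q ∣ (T *ᵥ (e - e')) j := by
    intro j
    rw [hsplit, Pi.add_apply]
    refine dvd_add ?_ ?_
    · show q ∣ ∑ k, T j k * w k
      exact Finset.dvd_sum fun k _ => dvd_mul_of_dvd_right (hw k) _
    · show q ∣ ∑ l, B j l * (s' - s) l
      exact Finset.dvd_sum fun l _ => dvd_mul_of_dvd_left (by rw [hBdef]; exact hTA j l) _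
  have hbound : ∀ j, |(T *ᵥ (e - e')) j| < q := by
    intro j
    show |∑ k, T j k * (e - e') k| < q
    calc |∑ k, T j k * (e - e') k| ≤ ∑ k, |T j k * (e - e') k| := Finset.abs_sum_le_sum_abs _ _
      _ = ∑ k, |T j k| * |(e - e') k| := by simp [abs_mul]
      _ ≤ ∑ k, |T j k| * (2 * D) := by
          apply Finset.sum_le_sum
          intro k _
          apply mul_le_mul_of_nonneg_left _ (abs_nonneg _)
          calc |(e - e') k| = |e k - e' k| := by simp
            _ ≤ |e k| + |e' k| := abs_sub _ _
            _ ≤ D + D := add_le_add (he k) (he' k)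
            _ = 2 * D := by ring
      _ = 2 * D * ∑ k, |T j k| := by rw [← Finset.sum_mul]; ring
      _ < q := hTshort j
  have hzero : T *ᵥ (e - e') = 0 := by
    funext j
    exact Int.eq_zero_of_abs_lt_dvd (hdvd j) (hbound j)
  have hee : e - e' = 0 := Matrix.eq_zero_of_mulVec_eq_zero hTdet hzero
  exact sub_eq_zero.mp hee

/-- **… and unique secret mod q under a rank certificate.**  If moreover `L * A ≡ 1 (mod q)`
entrywise (a left inverse of `A` mod `q`, i.e. `A` has full column rank mod `q`), then
`s ≡ s' (mod q)` coordinatewise.  Together with `lwePair_uniqueError` this is the disjointness of the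
pair `U_i = {(A,b,ρ) : ∃ s e T L …, b ≡ As+e, ‖e‖∞ ≤ D, GL_ρ(s mod q, e) = i}` (`i = 0,1`). -/
theorem lwePair_uniqueSecret {m n : ℕ} (q : ℤ)
    (A : Matrix (Fin m) (Fin n) ℤ) (L : Matrix (Fin n) (Fin m) ℤ)
    (hL : ∀ i i', q ∣ (L * A - (1 : Matrix (Fin n) (Fin n) ℤ)) i i')
    (s s' : Fin n → ℤ) (e : Fin m → ℤ)
    (hb : ∀ j, q ∣ (A *ᵥ s + e) j - (A *ᵥ s' + e) j) :
    ∀ i, q ∣ s i - s' i := by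
  -- A (s - s') ≡ 0, hence (L A)(s - s') ≡ 0, hence (s - s') ≡ (1 - L A)(s - s') ≡ 0.
  have hA : ∀ j, q ∣ (A *ᵥ (s - s')) j := by
    intro j
    have h1 : (A *ᵥ (s - s')) j = (A *ᵥ s + e) j - (A *ᵥ s' + e) j := by
      simp only [Matrix.mulVec_sub, Pi.sub_apply, Pi.add_apply]
      ring
    rw [h1]
    exact hb j
  intro i
  set C : Matrix (Fin n) (Fin n) ℤ := L * A - (1 : Matrix (Fin n) (Fin n) ℤ) with hCdef
  have hsplit : (s - s') i = ((L * A) *ᵥ (s - s')) i - (C *ᵥ (s - s')) i := by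
    have : (L * A) *ᵥ (s - s') - C *ᵥ (s - s') = s - s' := by
      rw [← Matrix.sub_mulVec, hCdef, sub_sub_cancel, Matrix.one_mulVec]
    rw [← Pi.sub_apply, this]
  have h2 : q ∣ ((L * A) *ᵥ (s - s')) i := by
    rw [← Matrix.mulVec_mulVec]
    show q ∣ ∑ j, L i j * (A *ᵥ (s - s')) j
    exact Finset.dvd_sum fun j _ => dvd_mul_of_dvd_right (hA j) _
  have h3 : q ∣ (C *ᵥ (s - s')) i := by
    show q ∣ ∑ j, C i j * (s - s') j
    exact Finset.dvd_sum fun j _ => dvd_mul_of_dvd_left (by rw [hCdef]; exact hL i j) _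
  have h4 : (s - s') i = s i - s' i := rfl
  rw [← h4, hsplit]
  exact dvd_sub h2 h3

/-- **Shape of the line.**  Krajíček's Theorem 4.1 (arXiv:2506.20221 / LMCS 22(2:14) 2026):
an affirmative answer to his Problem 3.2 (`ModelExt`: Σᵇ₁(PV)-elementary, length-preserving
extensions of models of the true universal theory `T_PV` falsifying a given unprovable formula)
together with Hypothesis (ST) (`ST`: for some strong pps `P`, the disjoint-disjunction search
problem `DD_P` is not solvable by a p-time student in `O(1)` rounds) yields `NP ≠ coNP`; the crux
`Target` then follows by the LANDED tree lemma `latticeMagicTarget_of_NP_ne_coNP`.  Here both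
notions enter abstractly; the card's stubs S2–S4 type them over `Literature.Analysis.FunctionSpaces.
trueUnivPV` / `Literature.Computability.MetaComplexity.IsProofSystemFor`. [cite: arXiv:2506.20221, Thm 4.1] -/
theorem target_of_krajicekSplit {ModelExt ST : Prop}
    (thm41 : ModelExt → ST → Literature.Computability.Complexity.Nondeterministic.NP ≠
      Literature.Computability.Complexity.coNP)
    (hM : ModelExt) (hST : ST) : Summit.PneNP.PneNP.Theses.LatticeMagic.Target :=
  Summit.PneNP.PneNP.Theorems.latticeMagicTarget_of_NP_ne_coNP (thm41 hM hST)

end Summit.PneNP.PneNP.Cruxes.Target.Ideator4
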